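import Summits.Ventures.PercRepro.Night2ThreeOneTen
import Summits.Ventures.PercRepro.Night2CoverBasesTwoFat
import Summits.Ventures.PercRepro.Night2ExcessCellsA
import Summits.Ventures.PercRepro.Night2ExcessCellsB

/-!
# PercRepro — the `(7, 5)` cells `(3, 1)` at `|G| = 17` and `(3, 0)` at `|G| = 13` through TWO fat hyperplanes; residues E (night-2, gen 22)

Two thin members `B₀, B₁` of a flat `G` whose closures miss `≤ 2` points each and miss DIFFERENT point sets give two
rank-`q` sets `H₀ = cl B₀`, `H₁ = cl B₁ ⊇ K` whose missed sets overlap in `≤ 1` point; the inclusion–exclusion of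
`card_coverBases_le_of_two_subset_rank` then bounds the covering bases of a target of size `s` (off the coloops) by
`cntTwo ρ s = C(s, ρ) − 2·C(s − 2, ρ) + C(s − 3, ρ)` (`card_coverBases_le_cntTwo`; the worst case is `|S′ ∖ H₀| = |S′ ∖ H₁| = 2`
with one shared missed point — `choose_two_fat_le` is the binomial convexity behind it).  With the chord excess of gen 20 the
count sum of `localShadowHall_excess_of_count` is `1.134 ≥ 1` for `(3, 1)` at `n = 16` (`countSum_three_one_sixteen`) and
`1.068 ≥ 1` for `(3, 0)` at `n = 13` (`countSum_three_zero_thirteen`).  Hence the cells `(3, 1)` at `|G| = 17` and `(3, 0)` at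
`|G| = 13` close whenever two fat thin members miss different sets, and **`shadowHall_seven_five_of_residuesE`**: the `(7, 5)`
shadow row modulo the residues of D with, at those two sizes, the extra clause `OneFatHyperplane` (every thin member missing
`≤ 2` points misses the SAME set).
-/

namespace PercRepro.Shadow

open Finset PerFlat ThmH

/-- The count function of two distinct fat hyperplanes missing `≤ 2` points each:
`C(s, ρ) − 2·C(s − 2, ρ) + C(s − 3, ρ)`. -/
noncomputable def cntTwo (ρ s : ℕ) : ℚ :=
  (s.choose ρ : ℚ) - 2 * ((s - 2).choose ρ : ℚ) + ((s - 3).choose ρ : ℚ)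

/-- `cntTwo 5 s > 0` for `6 ≤ s ≤ 16`. -/
theorem cntTwo_five_pos : ∀ s, 6 ≤ s → s ≤ 16 → 0 < cntTwo 5 s := by
  intro s h1 h2
  unfold cntTwo
  interval_cases s <;> norm_num [Nat.choose_eq_descFactorial_div_factorial, Nat.descFactorial, Nat.factorial]

/-- `cntTwo 6 s > 0` for `7 ≤ s ≤ 13`. -/
theorem cntTwo_six_pos : ∀ s, 7 ≤ s → s ≤ 13 → 0 < cntTwo 6 s := by
  intro s h1 h2
  unfold cntTwo
  interval_cases s <;> norm_num [Nat.choose_eq_descFactorial_div_factorial, Nat.descFactorial, Nat.factorial]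

/-- **Binomial convexity behind the two-hyperplane count**: for `a₀, a₁ ≤ 2` (the points of a target missed by the two
hyperplanes), `b_i + a_i = m + 3` (the traces) and `x` (the common trace) with `x ≤ b₀, b₁` and `x + a₀ + a₁ ≤ m + 4`
(one shared missed point at most), `C(x, r+1) + 2·C(m+1, r+1) ≤ C(b₀, r+1) + C(b₁, r+1) + C(m, r+1)`. -/
theorem choose_two_fat_le (r m a₀ a₁ b₀ b₁ x : ℕ) (h₀ : a₀ ≤ 2) (h₁ : a₁ ≤ 2)
    (hb₀ : b₀ + a₀ = m + 3) (hb₁ : b₁ + a₁ = m + 3) (hx₀ : x ≤ b₀) (hx₁ : x ≤ b₁)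
    (hx : x + a₀ + a₁ ≤ m + 4) :
    x.choose (r + 1) + 2 * (m + 1).choose (r + 1) ≤
      b₀.choose (r + 1) + b₁.choose (r + 1) + m.choose (r + 1) := by
  have p1 : (m + 1).choose (r + 1) = m.choose r + m.choose (r + 1) := Nat.choose_succ_succ m r
  have p2 : (m + 2).choose (r + 1) = (m + 1).choose r + (m + 1).choose (r + 1) :=
    Nat.choose_succ_succ (m + 1) r
  have p3 : (m + 3).choose (r + 1) = (m + 2).choose r + (m + 2).choose (r + 1) :=
    Nat.choose_succ_succ (m + 2) r
  have q1 : m.choose r ≤ (m + 1).choose r := Nat.choose_le_choose r (by omega)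
  have q2 : (m + 1).choose r ≤ (m + 2).choose r := Nat.choose_le_choose r (by omega)
  interval_cases a₀ <;> interval_cases a₁ <;>
    rcases (show b₀ = m + 3 ∨ b₀ = m + 2 ∨ b₀ = m + 1 by omega) with rfl | rfl | rfl <;>
    rcases (show b₁ = m + 3 ∨ b₁ = m + 2 ∨ b₁ = m + 1 by omega) with rfl | rfl | rfl <;>
    rcases (show x ≤ m ∨ x = m + 1 ∨ x = m + 2 ∨ x = m + 3 by omega) with h | rfl | rfl | rfl <;>
    first
      | omega
      | (have hxc := Nat.choose_le_choose (r + 1) h; omega)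

/-- Two different sets of size `≤ 2` meet in at most one point. -/
theorem card_inter_le_one_of_ne {α : Type*} [DecidableEq α] {X Y : Finset α}
    (hX : X.card ≤ 2) (hY : Y.card ≤ 2) (hne : X ≠ Y) : (X ∩ Y).card ≤ 1 := by
  by_contra h
  push Not at h
  have hXeq : X ∩ Y = X :=
    Finset.eq_of_subset_of_card_le Finset.inter_subset_left (by omega)
  have hYeq : X ∩ Y = Y :=
    Finset.eq_of_subset_of_card_le Finset.inter_subset_right (by omega)
  exact hne (hXeq.symm.trans hYeq)

variable {α : Type*} [DecidableEq α] {M : Matroid α} [M.Finite]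

open scoped Classical in
/-- **The two-hyperplane count**: two rank-`≤ q` sets `H₀, H₁ ⊇ K` missing `≤ 2` points of `G` each and missing DIFFERENT
sets bound the covering bases of every target `S ⊆ G` by `cntTwo ρ |S ∖ K|`. -/
theorem card_coverBases_le_cntTwo {q ρ : ℕ} {G : Finset α} (hk : kColoops M G + ρ = q + 1) (hρ : 3 ≤ ρ)
    {H₀ H₁ : Finset α} (hK₀ : coloops M G ⊆ H₀) (hH₀ : M.eRk (H₀ : Set α) ≤ (q : ℕ∞))
    (hK₁ : coloops M G ⊆ H₁) (hH₁ : M.eRk (H₁ : Set α) ≤ (q : ℕ∞))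
    (hm₀ : (G \ H₀).card ≤ 2) (hm₁ : (G \ H₁).card ≤ 2) (hne : G \ H₀ ≠ G \ H₁)
    {S : Finset α} (hSG : S ⊆ G) :
    ((coverBases M G S ρ).card : ℚ) ≤ cntTwo ρ (S \ coloops M G).card := by
  set S' := S \ coloops M G with hS'
  have hS'G : S' ⊆ G := Finset.sdiff_subset.trans hSG
  by_cases hsmall : S'.card < ρ
  · -- no `ρ`-subset at all
    have h0 : (coverBases M G S ρ).card ≤ S'.card.choose ρ := card_coverBases_le G S ρ
    rw [Nat.choose_eq_zero_of_lt hsmall] at h0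
    have h0' : (coverBases M G S ρ).card = 0 := by omega
    unfold cntTwo
    rw [h0', Nat.choose_eq_zero_of_lt hsmall, Nat.choose_eq_zero_of_lt (by omega),
      Nat.choose_eq_zero_of_lt (by omega)]
    norm_num
  push Not at hsmall
  obtain ⟨r, rfl⟩ : ∃ r, ρ = r + 1 := ⟨ρ - 1, by omega⟩
  obtain ⟨m, hm⟩ : ∃ m, S'.card = m + 3 := ⟨S'.card - 3, by omega⟩
  have h1 := card_coverBases_le_of_two_subset_rank hk hK₀ hH₀ hK₁ hH₁ S
  have h2 := card_inter_inter_le (H₀ := H₀) (H₁ := H₁) hS'G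
  have hc : ((G \ H₀) ∩ (G \ H₁)).card ≤ 1 := card_inter_le_one_of_ne hm₀ hm₁ hne
  have ha₀ : (S' \ H₀).card ≤ 2 := (Finset.card_le_card (Finset.sdiff_subset_sdiff hS'G le_rfl)).trans hm₀
  have ha₁ : (S' \ H₁).card ≤ 2 := (Finset.card_le_card (Finset.sdiff_subset_sdiff hS'G le_rfl)).trans hm₁
  have hb₀ := Finset.card_sdiff_add_card_inter S' H₀
  have hb₁ := Finset.card_sdiff_add_card_inter S' H₁
  have hx₀ : (S' ∩ H₀ ∩ H₁).card ≤ (S' ∩ H₀).card := Finset.card_le_card Finset.inter_subset_left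
  have hx₁ : (S' ∩ H₀ ∩ H₁).card ≤ (S' ∩ H₁).card := by
    apply Finset.card_le_card
    intro y hy
    simp only [Finset.mem_inter] at hy ⊢
    exact ⟨hy.1.1, hy.2⟩
  have h3 := choose_two_fat_le r m (S' \ H₀).card (S' \ H₁).card (S' ∩ H₀).card (S' ∩ H₁).card
    (S' ∩ H₀ ∩ H₁).card ha₀ ha₁ (by omega) (by omega) hx₀ hx₁ (by omega)
  rw [← hS'] at h1
  rw [hm] at h1
  have h4 : (coverBases M G S (r + 1)).card + 2 * (m + 1).choose (r + 1) ≤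
      (m + 3).choose (r + 1) + m.choose (r + 1) := by omega
  unfold cntTwo
  rw [hm, show m + 3 - 2 = m + 1 by omega, show m + 3 - 3 = m by omega]
  have h5 := (Nat.cast_le (α := ℚ)).2 h4
  push_cast at h5
  linarith

/-- `c′ = 1/15` at `(q, d, ρ, k, m₁) = (5, 3, 6, 0, 2)`. -/
theorem cPrimeDGP_three_zero_two : cPrimeDGP 5 3 6 0 2 = (1 / 15 : ℚ) := by
  unfold cPrimeDGP capDG reqDGP phiQ; norm_num

/-- The count sum of the cell `(3, 1)` at `n = 16` with the two-hyperplane count and `E = 349/1800`: `1.134… ≥ 1`. -/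
theorem countSum_three_one_sixteen :
    1 ≤ countSum 16 5 3 (cPrimeDGP 5 3 5 1 2) (349 / 1800 : ℚ) (cntTwo 5) := by
  rw [cPrimeDGP_three_one_two]
  unfold countSum DGenP.cjG cntTwo
  rw [show Finset.Icc 1 (16 - 5) = {1, 2, 3, 4, 5, 6, 7, 8, 9, 10, 11} by decide]
  repeat rw [Finset.sum_insert (by decide)]
  rw [Finset.sum_singleton]
  norm_num [Nat.choose_eq_descFactorial_div_factorial, Nat.descFactorial, Nat.factorial]

/-- The count sum of the cell `(3, 0)` at `n = 13` with the two-hyperplane count and `E = 38/165`: `1.068… ≥ 1`. -/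
theorem countSum_three_zero_thirteen :
    1 ≤ countSum 13 6 3 (cPrimeDGP 5 3 6 0 2) (38 / 165 : ℚ) (cntTwo 6) := by
  rw [cPrimeDGP_three_zero_two]
  unfold countSum DGenP.cjG cntTwo
  rw [show Finset.Icc 1 (13 - 6) = {1, 2, 3, 4, 5, 6, 7} by decide]
  repeat rw [Finset.sum_insert (by decide)]
  rw [Finset.sum_singleton]
  norm_num [Nat.choose_eq_descFactorial_div_factorial, Nat.descFactorial, Nat.factorial]

/-- The coloops of `G` lie in the closure of every thin member. -/
theorem coloops_subset_clF_of_mem_thinMembers {q : ℕ} {G : Finset α} (hG : G ∈ flatsQ M (q + 1))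
    (hd' : (gr M \ G).card ≤ q) {B : Finset α} (hB : B ∈ thinMembers M q G) :
    coloops M G ⊆ clF M B :=
  (coloops_subset_of_mem_thinMembers hG hd' hB).trans
    (subset_clF (mem_membersIn.1 (mem_thinMembers.1 hB).1).1)

/-- The closure of a thin member has rank `≤ q`. -/
theorem eRk_clF_le_of_mem_thinMembers {q : ℕ} {G : Finset α} {B : Finset α}
    (hB : B ∈ thinMembers M q G) : M.eRk ((clF M B : Finset α) : Set α) ≤ (q : ℕ∞) := by
  have hBU : B ∈ Uq M (q + 2) q := (mem_membersIn.1 (mem_thinMembers.1 hB).1).1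
  rw [coe_clF, M.eRk_closure_eq, (mem_Uq.1 hBU).2.1]

open scoped Classical in
/-- **The cell `(3, 1)` at `|G| = 17` with two fat thin members missing DIFFERENT sets** (`≤ 2` points each):
(LI_G) through the two-hyperplane count of the covering bases. -/
theorem localShadowHall_three_one_five_seventeen_of_twoFat {G : Finset α} (hG : G ∈ flatsQ M (5 + 1))
    (hd : (gr M \ G).card = 3) (hk : kColoops M G = 1)
    (hs : ∀ e ∈ gr M, ∀ f ∈ gr M, e ≠ f → rkN M {e, f} = 2) (hl : ∀ e ∈ gr M, M.Indep {e})
    (hn : G.card = 17) {B₀ B₁ : Finset α} (hB₀ : B₀ ∈ thinMembers M 5 G) (hB₁ : B₁ ∈ thinMembers M 5 G)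
    (hfat₀ : (G \ clF M B₀).card ≤ 2) (hfat₁ : (G \ clF M B₁).card ≤ 2)
    (hne : G \ clF M B₀ ≠ G \ clF M B₁) :
    LocalShadowHall M 5 G := by
  have hk' : kColoops M G + 5 = 5 + 1 := by omega
  have hd' : (gr M \ G).card ≤ 5 := by omega
  have hm2 : ∀ B ∈ thinMembers M 5 G, 5 ≤ (B \ coloops M G).card → 2 ≤ (G \ clF M B).card :=
    fun B hB _ => two_le_card_sdiff_of_not_lay0 hG hd' (mem_thinMembers.1 hB).1 (mem_thinMembers.1 hB).2
  have hc2 : 0 ≤ cPrimeDGP 5 3 5 (kColoops M G) 2 := by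
    rw [hk]; unfold cPrimeDGP capDG reqDGP phiQ; norm_num
  have hn16 : G.card - kColoops M G = 16 := by omega
  have hKG : coloops M G ⊆ G := fun y hy => (mem_coloops.1 hy).1
  have hnK : (G \ coloops M G).card = 16 := by
    rw [Finset.card_sdiff_of_subset hKG, ← kColoops_eq_card_coloops]; omega
  refine localShadowHall_excess_of_count (d := 3) (ρ := 5) (m₁ := 2) hG hd (by norm_num) hk' (by norm_num)
    hs hl hc2 hm2 (E := (349 / 1800 : ℚ)) (by norm_num) ?_ (cnt := cntTwo 5) ?_ ?_ ?_
  · intro S _ T hT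
    have hT' : T ∈ (S \ coloops M G).powersetCard 5 := by
      unfold coverBases at hT
      exact (Finset.mem_filter.1 hT).1
    have h := sum_faceLoss_union_le (a := (17 / 75 : ℚ)) (b := (1 / 75 : ℚ)) hG hd (by norm_num) hk' (by omega)
      hs hl (by norm_num) (by rw [hnK]; intro m h1 h2; exact DGenP.chord_three_one_16 m h1 (by omega))
      (by rw [hnK, hk, DGenP.excessBound_three_one_16]; norm_num) hT'
    rw [hnK, hk, DGenP.excessBound_three_one_16] at h
    exact h
  · intro s h1 h2
    rw [hn16] at h2
    exact cntTwo_five_pos s h1 h2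
  · intro S hSG
    exact card_coverBases_le_cntTwo hk' (by norm_num) (coloops_subset_clF_of_mem_thinMembers hG hd' hB₀)
      (eRk_clF_le_of_mem_thinMembers hB₀) (coloops_subset_clF_of_mem_thinMembers hG hd' hB₁)
      (eRk_clF_le_of_mem_thinMembers hB₁) hfat₀ hfat₁ hne hSG
  · rw [hn16, hk]
    exact countSum_three_one_sixteen

open scoped Classical in
/-- **The cell `(3, 0)` at `|G| = 13` with two fat thin members missing DIFFERENT sets** (`≤ 2` points each):
(LI_G) through the two-hyperplane count of the covering bases. -/
theorem localShadowHall_three_zero_six_thirteen_of_twoFat {G : Finset α} (hG : G ∈ flatsQ M (5 + 1))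
    (hd : (gr M \ G).card = 3) (hk : kColoops M G = 0)
    (hs : ∀ e ∈ gr M, ∀ f ∈ gr M, e ≠ f → rkN M {e, f} = 2) (hl : ∀ e ∈ gr M, M.Indep {e})
    (hn : G.card = 13) {B₀ B₁ : Finset α} (hB₀ : B₀ ∈ thinMembers M 5 G) (hB₁ : B₁ ∈ thinMembers M 5 G)
    (hfat₀ : (G \ clF M B₀).card ≤ 2) (hfat₁ : (G \ clF M B₁).card ≤ 2)
    (hne : G \ clF M B₀ ≠ G \ clF M B₁) :
    LocalShadowHall M 5 G := by
  have hk' : kColoops M G + 6 = 5 + 1 := by omega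
  have hd' : (gr M \ G).card ≤ 5 := by omega
  have hm2 : ∀ B ∈ thinMembers M 5 G, 6 ≤ (B \ coloops M G).card → 2 ≤ (G \ clF M B).card :=
    fun B hB _ => two_le_card_sdiff_of_not_lay0 hG hd' (mem_thinMembers.1 hB).1 (mem_thinMembers.1 hB).2
  have hc2 : 0 ≤ cPrimeDGP 5 3 6 (kColoops M G) 2 := by
    rw [hk]; unfold cPrimeDGP capDG reqDGP phiQ; norm_num
  have hn13 : G.card - kColoops M G = 13 := by omega
  have hKG : coloops M G ⊆ G := fun y hy => (mem_coloops.1 hy).1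
  have hnK : (G \ coloops M G).card = 13 := by
    rw [Finset.card_sdiff_of_subset hKG, ← kColoops_eq_card_coloops]; omega
  refine localShadowHall_excess_of_count (d := 3) (ρ := 6) (m₁ := 2) hG hd (by norm_num) hk' (by norm_num)
    hs hl hc2 hm2 (E := (38 / 165 : ℚ)) (by norm_num) ?_ (cnt := cntTwo 6) ?_ ?_ ?_
  · intro S _ T hT
    have hT' : T ∈ (S \ coloops M G).powersetCard 6 := by
      unfold coverBases at hT
      exact (Finset.mem_filter.1 hT).1
    have h := sum_faceLoss_union_le (a := (13 / 55 : ℚ)) (b := (1 / 55 : ℚ)) hG hd (by norm_num) hk' (by omega)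
      hs hl (by norm_num) (by rw [hnK]; intro m h1 h2; exact DGenP.chord_three_zero_13 m h1 (by omega))
      (by rw [hnK, hk, DGenP.excessBound_three_zero_13]; norm_num) hT'
    rw [hnK, hk, DGenP.excessBound_three_zero_13] at h
    exact h
  · intro s h1 h2
    rw [hn13] at h2
    exact cntTwo_six_pos s h1 h2
  · intro S hSG
    exact card_coverBases_le_cntTwo hk' (by norm_num) (coloops_subset_clF_of_mem_thinMembers hG hd' hB₀)
      (eRk_clF_le_of_mem_thinMembers hB₀) (coloops_subset_clF_of_mem_thinMembers hG hd' hB₁)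
      (eRk_clF_le_of_mem_thinMembers hB₁) hfat₀ hfat₁ hne hSG
  · rw [hn13, hk]
    exact countSum_three_zero_thirteen

section SevenFiveE

variable {α' : Type} [DecidableEq α']

/-- «every thin member missing `≤ m` points misses the SAME set of points» — one fat hyperplane only. -/
abbrev OneFatHyperplane (N : Matroid α') [N.Finite] (G : Finset α') (m : ℕ) : Prop :=
  ∀ B₀ ∈ thinMembers N 5 G, ∀ B₁ ∈ thinMembers N 5 G,
    (G \ clF N B₀).card ≤ m → (G \ clF N B₁).card ≤ m → G \ clF N B₀ = G \ clF N B₁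

/-- **THE `(7, 5)` SHADOW ROW FOR EVERY FINITE MATROID MODULO THE RESIDUES E**: the residues of
`shadowHall_seven_five_of_residuesD` with, at `(3, 0)`, `|G| = 13` and at `(3, 1)`, `|G| = 17`, the extra clause that all
the thin members missing `≤ 2` points miss the same set (`OneFatHyperplane`). -/
theorem shadowHall_seven_five_of_residuesE
    (h20 : ∀ (N : Matroid α') [N.Finite] (G : Finset α'), CellHyp N G →
      (gr N \ G).card = 2 → kColoops N G = 0 → FatMember N G 6 3 →
      (FatBasis N G 6 2 ∨ FatMember N G 6 2) → LocalShadowHall N 5 G)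
    (h21 : ∀ (N : Matroid α') [N.Finite] (G : Finset α'), CellHyp N G →
      (gr N \ G).card = 2 → kColoops N G = 1 → FatMember N G 5 4 →
      (FatBasis N G 5 3 ∨ FatMember N G 5 3) → LocalShadowHall N 5 G)
    (h30 : ∀ (N : Matroid α') [N.Finite] (G : Finset α'), CellHyp N G →
      (gr N \ G).card = 3 → kColoops N G = 0 → 10 ≤ G.card → G.card ≤ 13 → FatMember N G 6 2 →
      FatBasis N G 6 2 → (G.card = 13 → OneFatHyperplane N G 2) → LocalShadowHall N 5 G)
    (h31 : ∀ (N : Matroid α') [N.Finite] (G : Finset α'), CellHyp N G →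
      (gr N \ G).card = 3 → kColoops N G = 1 → 11 ≤ G.card → G.card ≤ 17 → FatMember N G 5 2 →
      (G.card = 17 → FatBasis N G 5 2) → (G.card = 17 → OneFatHyperplane N G 2) →
      (G.card = 11 ∨ G.card = 15 ∨ G.card = 16 → FatBasis N G 5 3) →
      (12 ≤ G.card ∧ G.card ≤ 14 → FatBasis N G 5 4) → LocalShadowHall N 5 G)
    (h32 : ∀ (N : Matroid α') [N.Finite] (G : Finset α'), CellHyp N G →
      (gr N \ G).card = 3 → kColoops N G = 2 → FatMember N G 4 2 → LocalShadowHall N 5 G)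
    (M : Matroid α') [M.Finite] : ShadowHall M 7 5 (phiK 7 5) := by
  apply shadowHall_seven_five_of_residuesD h20 h21 _ _ h32
  · intro N _ G hcell hd hk h10 h13 hfm hfb
    by_cases hone : OneFatHyperplane N G 2
    · exact h30 N G hcell hd hk h10 h13 hfm hfb (fun _ => hone)
    · by_cases hG13 : G.card = 13
      · unfold OneFatHyperplane at hone
        push Not at hone
        obtain ⟨B₀, hB₀, B₁, hB₁, hf₀, hf₁, hne⟩ := hone
        exact localShadowHall_three_zero_six_thirteen_of_twoFat hcell.2.2.2 hd hk hcell.1 hcell.2.1 hG13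
          hB₀ hB₁ hf₀ hf₁ hne
      · exact h30 N G hcell hd hk h10 h13 hfm hfb (fun h => absurd h hG13)
  · intro N _ G hcell hd hk h11 h17 hfm hb2 hb3 hb4
    by_cases hone : OneFatHyperplane N G 2
    · exact h31 N G hcell hd hk h11 h17 hfm hb2 (fun _ => hone) hb3 hb4
    · by_cases hG17 : G.card = 17
      · unfold OneFatHyperplane at hone
        push Not at hone
        obtain ⟨B₀, hB₀, B₁, hB₁, hf₀, hf₁, hne⟩ := hone
        exact localShadowHall_three_one_five_seventeen_of_twoFat hcell.2.2.2 hd hk hcell.1 hcell.2.1 hG17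
          hB₀ hB₁ hf₀ hf₁ hne
      · exact h31 N G hcell hd hk h11 h17 hfm hb2 (fun h => absurd h hG17) hb3 hb4

end SevenFiveE

end PercRepro.Shadow
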